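import Literature.Analysis.FluidPDE.SpaceTimeRescaling
import HarnessLib

/-!
# Route `ExtremiserTransience`, crux `NearExtremalTransiencePerFlow` (stmt-NavierStokesRegularity-26567) —
# LINE g9-β «filament selection», stub G `stub_growthTransfer`: GROWTH TRANSFER through the NS-compatible zoom

`--supports stmt-NavierStokesRegularity-26567`.  Prover seat ns-net-p2 (g5).  THE STATEMENT (`growthTransfer`, verbatim the
Prop `GrowthTransfer` of the crux workfile `Cruxes/NearExtremalTransiencePerFlow/Lines/filament_selection.lean`, Part C, with
`HasLinGrowth A W₀ := ∀ x R, 0 < R → ∫_{B(x,R)}‖W₀‖² ≤ A R` unfolded): if the slices `U n` obey the physical-units budget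
`∫_{B(x,r)}|U n|² ≤ A·ν²·r` (eventually in `n`, all `x`, all `r > 0`), then every pointwise limit `W₀` of translates of the
zooms `z ↦ (Mb n)⁻¹ • U n ((ν / Mb n) • z)` (continuous, height `≤ 1`) along a subsequence has `∫_{B(x,R)}|W₀|² ≤ A·R` for all
`x`, `R > 0` — the SAME constant.

PROOF.  (1) The budget is invariant under the zoom: with `L = ν/Mb n`, translation by `y n` and the space change of variables
`ζ = L•y n + L•z` (`integral_comp_space_affine`, `space_affine_preimage_ball`) give
`∫_{B(x,R)} ‖(Mb n)⁻¹ U n(L(y n + z))‖² dz = (Mb n)⁻² L⁻³ ∫_{B(L(y n + x), LR)} ‖U n‖² ≤ (Mb n)⁻² L⁻³ · Aν²·LR = A R`.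
(2) Dominated convergence on the ball (bound `1`, continuity for measurability) passes the bound to the pointwise limit.
Elementary; nothing about Navier–Stokes is used.  No summit is proved by a line; crux 26567 and NS regularity stay OPEN. [folklore]
-/

noncomputable section

open MeasureTheory Filter Set Metric Function Topology
open scoped Topology
open Literature.Analysis.FluidPDE

namespace Summit.NavierStokesRegularity.NavierStokesRegularity.Theorems

set_option linter.dupNamespace false

namespace NearExtremalTransiencePerFlow.FilamentSelection

/-- **Scale invariance of the local energy budget under the NS-compatible zoom.**  If `∫_{B(x,r)}‖U‖² ≤ A ν² r` for all `x`,
`r > 0`, then the zoom `z ↦ M⁻¹ • U ((ν/M) • (y + z))` (`M, ν > 0`) satisfies `∫_{B(x,R)}‖·‖² ≤ A R` for all `x`, `R > 0`. [folklore] -/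
theorem ballEnergy_zoom_le {ν A M : ℝ} (hν : 0 < ν) (hM : 0 < M)
    {U : EuclideanSpace ℝ (Fin 3) → EuclideanSpace ℝ (Fin 3)}
    (hU : ∀ (x : EuclideanSpace ℝ (Fin 3)) (r : ℝ), 0 < r → ∫ z in ball x r, ‖U z‖ ^ 2 ≤ A * ν ^ 2 * r)
    (y x : EuclideanSpace ℝ (Fin 3)) {R : ℝ} (hR : 0 < R) :
    ∫ z in ball x R, ‖M⁻¹ • U ((ν / M) • (y + z))‖ ^ 2 ≤ A * R := by
  set L : ℝ := ν / M with hL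
  have hL0 : 0 < L := div_pos hν hM
  -- the integrand as a function of `ζ = L•y + L•z`
  set g : EuclideanSpace ℝ (Fin 3) → ℝ := fun ζ => ‖M⁻¹ • U ζ‖ ^ 2 with hg
  have hpre : (fun z : EuclideanSpace ℝ (Fin 3) => L • y + L • z) ⁻¹' ball (L • y + L • x) (L * R) = ball x R := by
    rw [space_affine_preimage_ball hL0]
    congr 1
    · rw [add_sub_cancel_left, smul_smul, inv_mul_cancel₀ hL0.ne', one_smul]
    · field_simp
  have h1 : ∫ z in ball x R, ‖M⁻¹ • U ((ν / M) • (y + z))‖ ^ 2 =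
      ∫ z, (ball (L • y + L • x) (L * R)).indicator g (L • y + L • z) := by
    rw [← integral_indicator measurableSet_ball, ← hpre]
    refine integral_congr_ae (Eventually.of_forall fun z => ?_)
    have e : ∀ w : EuclideanSpace ℝ (Fin 3), (ν / M) • (y + w) = L • y + L • w := fun w => by
      rw [hL, smul_add]
    show ((fun z : EuclideanSpace ℝ (Fin 3) => L • y + L • z) ⁻¹' ball (L • y + L • x) (L * R)).indicator
        (fun z => ‖M⁻¹ • U ((ν / M) • (y + z))‖ ^ 2) z = (ball (L • y + L • x) (L * R)).indicator g (L • y + L • z)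
    rw [← Set.indicator_comp_right (fun z : EuclideanSpace ℝ (Fin 3) => L • y + L • z)]
    congr 1
    funext w
    simp only [Function.comp_apply, hg, e]
  have h2 : ∫ z, (ball (L • y + L • x) (L * R)).indicator g (L • y + L • z) =
      (L ^ 3)⁻¹ * ∫ ζ in ball (L • y + L • x) (L * R), g ζ := by
    have h := integral_comp_space_affine hL0 (L • y) ((ball (L • y + L • x) (L * R)).indicator g)
    rw [finrank_euclideanSpace_fin, smul_eq_mul, integral_indicator measurableSet_ball] at h
    exact h
  have h3 : ∫ ζ in ball (L • y + L • x) (L * R), g ζ = (M ^ 2)⁻¹ * ∫ ζ in ball (L • y + L • x) (L * R), ‖U ζ‖ ^ 2 := by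
    rw [← integral_const_mul]
    refine setIntegral_congr_fun measurableSet_ball fun ζ _ => ?_
    rw [hg]
    simp only
    rw [norm_smul, mul_pow, Real.norm_eq_abs, abs_inv, abs_of_pos hM, inv_pow]
  have h4 := hU (L • y + L • x) (L * R) (mul_pos hL0 hR)
  rw [h1, h2, h3]
  have hLM : L * M = ν := by rw [hL, div_mul_cancel₀ ν hM.ne']
  calc (L ^ 3)⁻¹ * ((M ^ 2)⁻¹ * ∫ ζ in ball (L • y + L • x) (L * R), ‖U ζ‖ ^ 2)
      ≤ (L ^ 3)⁻¹ * ((M ^ 2)⁻¹ * (A * ν ^ 2 * (L * R))) := by gcongr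
    _ = A * R * (ν ^ 2 / (L * M) ^ 2) := by field_simp
    _ = A * R := by rw [hLM, div_self (pow_ne_zero 2 hν.ne'), mul_one]

/-- **G `stub_growthTransfer` — GROWTH TRANSFER** (verbatim the Prop `GrowthTransfer` of
`Cruxes/NearExtremalTransiencePerFlow/Lines/filament_selection.lean`, Part C, with `HasLinGrowth` unfolded).  If the slices `U n` obey
`∫_{B(x,r)}|U n|² ≤ A·ν²·r` eventually in `n` (all `x`, all `r > 0`), then every pointwise limit `W₀` of translates of the zooms
`z ↦ (Mb n)⁻¹ • U n ((ν / Mb n) • z)` (continuous, height `≤ 1`) along a subsequence `φ` satisfies `∫_{B(x,R)}|W₀|² ≤ A·R` for all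
`x` and `R > 0`: scale invariance of the budget (`ballEnergy_zoom_le`) and dominated convergence on the ball. [folklore] -/
theorem growthTransfer :
    ∀ (ν A : ℝ) (U : ℕ → EuclideanSpace ℝ (Fin 3) → EuclideanSpace ℝ (Fin 3)) (Mb : ℕ → ℝ)
      (y : ℕ → EuclideanSpace ℝ (Fin 3)) (φ : ℕ → ℕ) (W₀ : EuclideanSpace ℝ (Fin 3) → EuclideanSpace ℝ (Fin 3)),
    0 < ν → (∀ n, 0 < Mb n) →
    (∀ n, Continuous fun z : EuclideanSpace ℝ (Fin 3) => (Mb n)⁻¹ • U n ((ν / Mb n) • z)) →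
    (∀ n (z : EuclideanSpace ℝ (Fin 3)), ‖(Mb n)⁻¹ • U n ((ν / Mb n) • z)‖ ≤ 1) →
    (∀ᶠ n in atTop, ∀ (x : EuclideanSpace ℝ (Fin 3)) (r : ℝ), 0 < r →
      ∫ z in Metric.ball x r, ‖U n z‖ ^ 2 ≤ A * ν ^ 2 * r) →
    StrictMono φ →
    (∀ z, Tendsto (fun n => (Mb (φ n))⁻¹ • U (φ n) ((ν / Mb (φ n)) • (y (φ n) + z))) atTop (𝓝 (W₀ z))) →
    ∀ (x : EuclideanSpace ℝ (Fin 3)) (R : ℝ), 0 < R → ∫ z in Metric.ball x R, ‖W₀ z‖ ^ 2 ≤ A * R := by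
  intro ν A U Mb y φ W₀ hν hMb hcont hle hbudget hφ hlim x R hR
  -- the translated zooms along `φ`
  set w : ℕ → EuclideanSpace ℝ (Fin 3) → EuclideanSpace ℝ (Fin 3) :=
    fun n z => (Mb (φ n))⁻¹ • U (φ n) ((ν / Mb (φ n)) • (y (φ n) + z)) with hw
  -- (1) eventually along `φ`, the translated zooms have linear growth `A`
  have hev : ∀ᶠ n in atTop, ∫ z in ball x R, ‖w n z‖ ^ 2 ≤ A * R := by
    filter_upwards [hφ.tendsto_atTop.eventually hbudget] with n hn
    exact ballEnergy_zoom_le hν (hMb (φ n)) hn (y (φ n)) x hR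
  -- (2) dominated convergence on the ball
  have hwcont : ∀ n, Continuous (w n) := fun n =>
    (hcont (φ n)).comp (continuous_const.add continuous_id)
  have hconv : Tendsto (fun n => ∫ z in ball x R, ‖w n z‖ ^ 2) atTop (𝓝 (∫ z in ball x R, ‖W₀ z‖ ^ 2)) := by
    refine tendsto_integral_of_dominated_convergence (fun _ => (1 : ℝ)) (fun n => ?_)
      (integrableOn_const measure_ball_lt_top.ne) (fun n => Eventually.of_forall fun z => ?_) ?_
    · exact ((hwcont n).norm.pow 2).aestronglyMeasurable
    · rw [norm_pow, norm_norm]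
      have h1 : ‖w n z‖ ≤ 1 := hle (φ n) (y (φ n) + z)
      calc ‖w n z‖ ^ 2 ≤ 1 ^ 2 := pow_le_pow_left₀ (norm_nonneg _) h1 2
        _ = 1 := one_pow 2
    · exact Eventually.of_forall fun z => ((hlim z).norm.pow 2)
  exact le_of_tendsto hconv hev

end NearExtremalTransiencePerFlow.FilamentSelection

end Summit.NavierStokesRegularity.NavierStokesRegularity.Theorems

end
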